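import Summits.Parity.GeneralizedHardyLittlewood.Theorems.GreenTaoLevelTwoGITwoCyclicInverseQuadMonomial

/-!
# Route `GreenTaoLevelTwo`, crux `GITwo` (stmt-Parity-21275), line `birth`, stub `stub_cyclicInverse`:
# a bracket linear monomial with cutoff is a Heisenberg-class nilsequence (GT08a arXiv Lemma 69,
# the functions (linear-xi))

Seventy-second helper file toward the XL stub `stub_cyclicInverse` (B. Green, T. Tao, *An inverse
theorem for the Gowers `U³(G)` norm*, arXiv:math/0503014, Thm. 68 = PEMS 51 (2008) Thm. 12.8).
Block E17 (arXiv §12, Lemma 69, first half): "Split `a_ξ = q + s`, where `q` is an integer and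
`|s| ≤ 1/2`, and observe that `e(q{ξ·n}) = e(qξn)` … Thus the function (linear-xi) takes the form
`n ↦ χ(ξn/N) e(s{ξn/N}) e(qξn/N)`. This function may be identified as the elementary nilsequence
… on the torus `(ℝ/ℤ)²` … `F(x,y) := χ(x)e(sx)e(y)`."  With `exists_linear_factor` (the factor
`χ(x)e(sx)`), `exists_circle_character` (the factor `e(y)`) and `exists_tensor_pair`:

* `exists_bracket_linear_monomial` — for `N` odd, `ξ ∈ ℤ/Nℤ` and ANY real `b`: a member `Z` of
  `InHeisClass H` (two circles) with a `1`-bounded `Ψ`, Lipschitz `(L_κ + 2π + 2/(½−r₂)) + 2π`, and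
  `Ψ(gⁿp) = κ(toAddCircle(nξ)) · e(b · valMinAbs(nξ)/N)` for all `n ∈ ℤ`.

References: [GreenTao2008U3Inverse] arXiv:math/0503014, §12, Lemma 69.
-/

noncomputable section

namespace Summit.Parity.GeneralizedHardyLittlewood.GreenTaoLevelTwoGITwoCyclicInverse

open Literature.NumberTheory.Sieve
open Literature.NumberTheory.Sieve.GreenTaoLevelTwo

/-- **A bracket linear monomial with cutoff is a Heisenberg-class nilsequence (arXiv Lemma 69,
(linear-xi)).**  For any `H`, a circle cutoff `κ` (`[0,1]`-valued, `L_κ`-Lipschitz, vanishing on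
`‖a‖ ≥ r₂`, `r₂ < ½`), `N` odd, `ξ ∈ ℤ/Nℤ` and `b ∈ ℝ`: a member `Z` of `InHeisClass H`, a
`1`-bounded `Ψ` with Lipschitz constant `(L_κ + 2π + 2/(½−r₂)) + 2π`, `g`, `p` with
`Ψ(gⁿp) = κ(toAddCircle(nξ)) e(b · valMinAbs(nξ)/N)` for all `n ∈ ℤ`.
[cite: GreenTao2008U3Inverse, §12, Lemma 69] -/
theorem exists_bracket_linear_monomial (H : Nilmanifold 2) {κ : AddCircle (1 : ℝ) → ℝ} {r₂ Lκ : ℝ}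
    (hr : r₂ < 1 / 2) (hκ : ∀ a, 0 ≤ κ a ∧ κ a ≤ 1) (hκ0 : ∀ a, r₂ ≤ ‖a‖ → κ a = 0)
    (hκL : ∀ a b, |κ a - κ b| ≤ Lκ * dist a b) (hLκ : 0 ≤ Lκ) {N : ℕ} [NeZero N] (hN : Odd N)
    (ξ : ZMod N) (b : ℝ) :
    ∃ Z : Nilmanifold 2, InHeisClass H Z ∧
      ∃ (Ψ : Z.G ⧸ Z.Γ → ℂ) (g : Z.G) (p : Z.G ⧸ Z.Γ),
        (∀ y, ‖Ψ y‖ ≤ 1) ∧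
        (∀ y z, ‖Ψ y - Ψ z‖ ≤ ((Lκ + 2 * Real.pi + 2 / (1 / 2 - r₂)) + 2 * Real.pi) * Z.dist y z) ∧
        ∀ n : ℤ, Ψ (g ^ n • p) =
          (κ (ZMod.toAddCircle ((n : ZMod N) * ξ)) : ℂ) *
            ((AddCircle.toCircle (((b * ((((n : ZMod N) * ξ).valMinAbs : ℝ) / N) : ℝ)) :
              AddCircle (1 : ℝ)) : Circle) : ℂ) := by
  obtain ⟨q, s, hbs, hs⟩ := exists_int_add_small b
  set α : ℝ := (ξ.valMinAbs : ℝ) / N with hα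
  have hgap : 0 < 1 / 2 - r₂ := by linarith
  obtain ⟨Φ₁, g₁, p₁, hb₁, hL₁, horb₁⟩ := exists_linear_factor hr hκ hκ0 hκL hLκ ξ s
    (by norm_num : 1 ≤ 2)
  obtain ⟨Φ₂, g₂, p₂, hb₂, hL₂, horb₂⟩ := exists_circle_character (q * α) 0 (by norm_num : 1 ≤ 2)
  have hK₁ : 0 ≤ Lκ + 2 * Real.pi * |s| + 2 / (1 / 2 - r₂) := by positivity
  obtain ⟨Z, hZ, Ψ, g, p, hb, hLZ, horb⟩ := exists_tensor_pair H InHeisClass.circle InHeisClass.circle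
    g₁ g₂ p₁ p₂ hK₁ Real.two_pi_pos.le hb₁ hb₂ hL₁ hL₂
  refine ⟨Z, hZ, Ψ, g, p, hb, fun y z => (hLZ y z).trans ?_, fun n => ?_⟩
  · refine mul_le_mul_of_nonneg_right ?_ (Z.dist_nonneg y z)
    have : 2 * Real.pi * |s| ≤ 2 * Real.pi := by nlinarith [Real.pi_pos, abs_nonneg s]
    linarith
  · rw [horb n, horb₁ n, horb₂ n, mul_assoc]
    congr 1
    -- `e(s m) e(q n α) = e(b m)` with `m = nα − [nα]`
    set m : ℝ := ((((n : ZMod N) * ξ).valMinAbs : ℝ)) / N with hm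
    have hmα : m = n * α - round ((n : ℝ) * α) := by
      have e : (n : ZMod N) * ξ = (((n * ξ.valMinAbs : ℤ)) : ZMod N) := by
        rw [Int.cast_mul, ZMod.coe_valMinAbs]
      rw [hm, e, valMinAbs_div_eq hN, hα]
      push_cast
      rw [show (n : ℝ) * (ξ.valMinAbs : ℝ) / N = n * ((ξ.valMinAbs : ℝ) / N) by ring]
    rw [← toCircle_coe_eq_exp, ← toCircle_coe_add_mul]
    have e1 : b * m = (s * m + (0 + n * (q * α))) + ((-(q * round ((n : ℝ) * α)) : ℤ) : ℝ) := by
      rw [hbs, hmα]; push_cast; ring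
    rw [e1, toCircle_coe_add_int]

end Summit.Parity.GeneralizedHardyLittlewood.GreenTaoLevelTwoGITwoCyclicInverse
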